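import Summits.QuantumAdvantage.QuantumAdvantage.Theorems.LinnikCubicClassGroupsDegreeOnePrimesEscapeClassPNTDHInputs
import Literature.NumberTheory.LFunctions.RayClassFamily
import Literature.NumberTheory.LFunctions.CyclicExtensionHeckeFactorisation
import Literature.NumberTheory.LFunctions.RayClassConductorUniqueness
import Literature.NumberTheory.LFunctions.PrimesInRayClasses
import Literature.NumberTheory.NumberFields.RayClassFieldOfCharacters
import HarnessLib

/-!
# Linnik's theorem for cosets of a congruence class group, V: effective repulsion of the exceptional zero of a
# real Hecke character from `s = 1` (Stark's phenomenon by class field theory)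

Topic `Summits/QuantumAdvantage/QuantumAdvantage/Theorems`, cell B2b-1 (linnik-cubic), PART A (gen 22); helper toward
the crux `DegreeOnePrimesEscape` (stmt-QuantumAdvantage-11543) of route `LinnikCubicClassGroups`.  HONEST FRAMING: the
value of this file is a THEOREM (kernel-checked, GRH-free, Siegel-free) — NOT summit progress.

**`rayRealZero_repulsion`**: for every `n > 1` there is `c₁ = c₁(n) ∈ (0, 1]` such that for every number field `K`
of degree `n`, every abelian Frobenius datum `f` killing the narrow ray `mod 𝔪 ≠ 0` with non-trivial characters
non-principal off `𝔪`, every REAL character `ψ₁` (`ψ₁ + ψ₁ = 0`) and every real zero `β₁ < 1` of the member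
`F_{ψ₁}` of the family (`ζ₁_K` for `ψ₁ = 0`, the entire Hecke `L`-function of the primitive associate of `ψ₁ ∘ f`
otherwise): `c₁ · Q_𝔪^{−8} ≤ 1 − β₁`, `Q_𝔪 = |d_K| n^n N𝔪`.  This is the effective input the Deuring–Heilbronn
form of Linnik's theorem needs (in print, sharper: Cho–Lemke Oliver–Zaman 2025, Lemma 12 (Stark)).

Proof (descent by class field theory, all inputs PROVED in the tree): the class field `E_{ψ₁}` of the ray class
character `ψ₁ ∘ f` (`exists_classField_character_of_isRayClassCharacter`: abelian, unramified off `𝔪`,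
`ψ₁(f v) = χ(Frob_v)` with `χ` injective) is QUADRATIC over `K` (`χ² = 1` on the Frobenii, which generate; `χ`
injective); the Hecke factorisation of a cyclic extension (`CyclicExtension.exists_primitive_heckeFactorisation`)
gives `ζ₁_E = ζ₁_K · L₁` with `L₁` the entire `L`-function of a primitive character `χ₁ mod 𝔣₁` with
`χ₁(v) = χ(Frob_v) = ψ₁(f v)` off `𝔪` and `|d_E| = |d_K|² N𝔣₁`; uniqueness of the primitive associate
(`IsPrimitive.modulus_unique` + density of primes in ray classes, `rayChar_congr_of_agree_off`) identifies `χ₁ mod 𝔣₁`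
with the primitive associate of `ψ₁ ∘ f`, so `L₁ = F_{ψ₁}` and `ζ₁_E(β₁) = 0`; Stark's effective bound for
`ζ_E` in degree `2n` (`Residue.one_sub_realZero_ge_condQn_rpow`) and `condQn E ≤ Q_𝔪⁴` finish.
References: H. M. Stark, Invent. Math. 23 (1974), Thm 3, Lemma 4 [Stark1974]; P. J. Cho, R. J. Lemke Oliver,
A. Zaman, arXiv:2510.02309 (2025), §5 Lemma 12 [ChoLemkeOliverZaman2025]; A. Weiss, J. reine angew. Math. 338
(1983), Lemma 1.? / §6 [Weiss1983].
-/

noncomputable section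

open Complex NumberField IsDedekindDomain IsDedekindDomain.HeightOneSpectrum Filter Field
open scoped NumberField nonZeroDivisors

namespace Summit.QuantumAdvantage.QuantumAdvantage.Theorems.DegreeOnePrimesEscape

open Literature.NumberTheory.LFunctions Literature.NumberTheory.LFunctions.NumberField
  Literature.NumberTheory.LFunctions.AbelianDensity Literature.NumberTheory.GaloisRepresentations
  Literature.NumberTheory.Automorphic Literature.NumberTheory.NumberFields
open scoped Classical

variable {K : Type} [Field K] [NumberField K]

/-! ### Ray class characters agreeing off a multiple of the modulus agree off the modulus -/

/-- **Two ray class characters `mod 𝔣 ≠ 0` which agree at the primes not dividing a nonzero `𝔫` agree at every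
prime not dividing `𝔣`** (every narrow ray class `mod 𝔣` contains a prime `∤ 𝔫`:
`exists_rayClassRel_prime_absNorm_not_mem`, and a ray class character is constant on narrow ray classes).
[cite: NeukirchANT1999, Ch. VII §6 Def. (6.8)] [cite: Landau1918Idealklassen, §1 Satz] -/
theorem rayChar_congr_of_agree_off {𝔣 𝔫 : Ideal (𝓞 K)} (h𝔣 : 𝔣 ≠ ⊥) (h𝔫 : 𝔫 ≠ ⊥)
    {χ χ' : HeightOneSpectrum (𝓞 K) → ℂ} (hχ : IsRayClassCharacter 𝔣 χ) (hχ' : IsRayClassCharacter 𝔣 χ')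
    (h : ∀ v : HeightOneSpectrum (𝓞 K), ¬ 𝔫 ≤ v.asIdeal → χ v = χ' v)
    (v : HeightOneSpectrum (𝓞 K)) (hv : ¬ 𝔣 ≤ v.asIdeal) : χ v = χ' v := by
  have hcop : IsCoprime v.asIdeal 𝔣 := Literature.NumberTheory.LFunctions.isCoprime_asIdeal_of_not_le h𝔣 hv
  set 𝔟 : CoprimeIdeal 𝔣 := ⟨v.asIdeal, v.ne_bot, hcop⟩ with h𝔟
  obtain ⟨w, hwS, -, hrel, -⟩ := exists_rayClassRel_prime_absNorm_not_mem h𝔣 𝔟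
    {w : HeightOneSpectrum (𝓞 K) | 𝔫 ≤ w.asIdeal} (finite_setOf_le_asIdeal h𝔫)
  have hw𝔫 : ¬ 𝔫 ≤ w.asIdeal := hwS
  have e1 := hχ.idealPow_eq_of_rayClassRel h𝔣 hrel v.ne_bot
  have e2 := hχ'.idealPow_eq_of_rayClassRel h𝔣 hrel v.ne_bot
  rw [idealPow_asIdeal, idealPow_asIdeal] at e1 e2
  rw [← e1, ← e2, h w hw𝔫]

/-! ### The descent: a real zero of `L_{ψ₁}` is a zero of `ζ₁_E` for a quadratic class field `E/K` -/

variable {G : Type} [CommGroup G] [Finite G] {𝔪 : Ideal (𝓞 K)} {f : HeightOneSpectrum (𝓞 K) → G}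
variable (h𝔪 : 𝔪 ≠ ⊥) (hray : ArtinKillsRay 𝔪 f)
  (hsep : ∀ χ : AddChar (Additive G) ℂ, χ ≠ 0 →
    ∃ v : HeightOneSpectrum (𝓞 K), ¬ 𝔪 ≤ v.asIdeal ∧ χ (Additive.ofMul (f v)) ≠ 1)

omit [NumberField K] [Finite G] in
/-- A real character squares to `1` on the primes off `𝔪`. -/
theorem charFun_sq_eq_one {ψ : AddChar (Additive G) ℂ} (hreal : ψ + ψ = 0) (v : HeightOneSpectrum (𝓞 K)) :
    charFun f ψ v ^ 2 = 1 := by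
  rw [sq, ← charFun_add, hreal]; simp [charFun, toMulHom_apply]

set_option maxHeartbeats 1600000 in
/-- **The descent.**  Let `ψ₁ ≠ 0` be a real character of the congruence class group and `β₁ ∈ (0,1)` a real zero
of `L_{ψ₁}` (the entire Hecke `L`-function of the primitive associate of `ψ₁ ∘ f`).  If `c > 0` is such that
`c · condQn(E)^{−2} ≤ 1 − β` for every number field `E` of degree `2 n_K` and every real zero `β < 1` of `ζ_E`
(Stark), then `c · Q_𝔪^{−8} ≤ 1 − β₁`: `β₁` is a zero of `ζ₁_E` for the quadratic class field `E` of `ψ₁ ∘ f`,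
and `condQn E = |d_E| (2n)^{2n} ≤ Q_𝔪⁴`. [cite: Stark1974, Theorem 3] [cite: ChoLemkeOliverZaman2025, §5 Lemma 12] -/
theorem one_sub_realZero_ge_of_descent (hK : 1 < Module.finrank ℚ K) {ψ₁ : AddChar (Additive G) ℂ}
    (hψ₁ : ψ₁ ≠ 0) (hreal : ψ₁ + ψ₁ = 0) {β₁ : ℝ} (hβ1 : β₁ < 1)
    (h0 : (datumData h𝔪 hray hsep ψ₁ hψ₁).L β₁ = 0) {c : ℝ} (hc : 0 < c)
    (hstark : ∀ (E : Type) [Field E] [NumberField E], Module.finrank ℚ E = 2 * Module.finrank ℚ K →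
      ∀ β : ℝ, β < 1 → classGroupLFunction E 1 β = 0 → c * ThornerZaman.condQn E ^ (-(2 : ℝ)) ≤ 1 - β) :
    c * rayCondQ K 𝔪 ^ (-(8 : ℝ)) ≤ 1 - β₁ := by
  set D := datumData h𝔪 hray hsep ψ₁ hψ₁ with hD
  set n : ℕ := Module.finrank ℚ K with hn
  -- (1) the class field of `ψ₁ ∘ f`
  have hχψ : IsRayClassCharacter 𝔪 (charFun f ψ₁) := isRayClassCharacter_toMulHom hray ψ₁
  obtain ⟨E, hEfd, hEab, hunrE, χ, hχinj, hχval⟩ := exists_classField_character_of_isRayClassCharacter h𝔪 hχψ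
  haveI := hEfd
  haveI := hEab
  haveI : NumberField E := NumberField.of_module_finite K E
  have hcommE : ∀ a b : E ≃ₐ[K] E, Commute a b := commute_of_isAbelianGalois E
  -- `ψ₁(f v) = χ(Frob_v)` for `v ∤ 𝔪`
  have hval : ∀ v : HeightOneSpectrum (𝓞 K), ¬ 𝔪 ≤ v.asIdeal →
      charFun f ψ₁ v = ((χ (galFrob K E v) : ℂˣ) : ℂ) := by
    intro v hv
    obtain ⟨𝔓v, h𝔓v⟩ := v.primesAbove_nonempty
    obtain ⟨σ, hσ⟩ := HeightOneSpectrum.exists_isArithFrobAt_of_mem_primesAbove_holds h𝔓v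
    rw [hχval v hv 𝔓v h𝔓v σ hσ]
    haveI : 𝔓v.IsPrime := h𝔓v.1
    have hP := comap_ringOfIntegersToIntegralClosure_mem_primesOver_of_mem_primesAbove E h𝔓v
    have hrσ := isArithFrobAt_absRestrictNormalHom E hσ
    rw [eq_galFrob hcommE (hunrE v hv) hP hrσ]
  -- (2) `χ² = 1`, values `±1`, `|Gal(E/K)| = 2`
  have hsqv : ∀ v : HeightOneSpectrum (𝓞 K), ¬ 𝔪 ≤ v.asIdeal → ((χ (galFrob K E v) : ℂˣ) : ℂ) ^ 2 = 1 := by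
    intro v hv; rw [← hval v hv]; exact charFun_sq_eq_one hreal v
  have hχsq : χ * χ = 1 := by
    refine MonoidHom.eq_one_of_forall_galFrob E (χ * χ) (finite_setOf_le_asIdeal h𝔪) fun v hv _ ↦ ?_
    rw [MonoidHom.mul_apply]
    ext
    rw [Units.val_mul, Units.val_one, ← sq]
    exact hsqv v hv
  have hpm : ∀ g : E ≃ₐ[K] E, ((χ g : ℂˣ) : ℂ) = 1 ∨ ((χ g : ℂˣ) : ℂ) = -1 := by
    intro g
    have h1 : ((χ g : ℂˣ) : ℂ) ^ 2 = 1 := by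
      have := DFunLike.congr_fun hχsq g
      rw [MonoidHom.mul_apply, MonoidHom.one_apply] at this
      have := congrArg (fun u : ℂˣ ↦ (u : ℂ)) this
      simpa [sq] using this
    exact sq_eq_one_iff.mp h1
  have hone : ∀ g : E ≃ₐ[K] E, ((χ g : ℂˣ) : ℂ) = 1 → g = 1 := by
    intro g hg
    apply hχinj
    rw [map_one]; exact Units.ext hg
  -- the non-trivial element
  obtain ⟨v₀, hv₀, hv₀1⟩ := hsep ψ₁ hψ₁
  have hg₀ : galFrob K E v₀ ≠ 1 := by
    intro h1
    apply hv₀1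
    have := hval v₀ hv₀
    rw [h1, map_one, Units.val_one] at this
    simpa [charFun, toMulHom_apply] using this
  have hcard : Nat.card (E ≃ₐ[K] E) = 2 := by
    have hle : Nat.card (E ≃ₐ[K] E) ≤ 2 := by
      have hinj : Function.Injective (fun g : E ≃ₐ[K] E ↦ decide (((χ g : ℂˣ) : ℂ) = 1)) := by
        intro g h hgh
        simp only [decide_eq_decide] at hgh
        apply hχinj
        ext
        rcases hpm g with hg1 | hg1 <;> rcases hpm h with hh1 | hh1
        · rw [hg1, hh1]
        · exact absurd (hgh.1 hg1) (by rw [hh1]; norm_num)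
        · exact absurd (hgh.2 hh1) (by rw [hg1]; norm_num)
        · rw [hg1, hh1]
      have := Nat.card_le_card_of_injective _ hinj
      simpa using this
    have hnt : Nontrivial (E ≃ₐ[K] E) := ⟨⟨galFrob K E v₀, 1, hg₀⟩⟩
    have hlt : 1 < Nat.card (E ≃ₐ[K] E) := Finite.one_lt_card_iff_nontrivial.mpr hnt
    omega
  haveI : Fact (Nat.Prime 2) := ⟨Nat.prime_two⟩
  haveI : IsCyclic (E ≃ₐ[K] E) := isCyclic_of_prime_card hcard
  have hdegKE : Module.finrank K E = 2 := by rw [← IsGalois.card_aut_eq_finrank K E, hcard]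
  have hdegE : Module.finrank ℚ E = 2 * n := by
    rw [← Module.finrank_mul_finrank ℚ K E, hdegKE, hn, mul_comm]
  have hsq1 : ∀ g : E ≃ₐ[K] E, g ^ 2 = 1 := fun g ↦ by rw [← hcard]; exact pow_card_eq_one'
  -- (3) the Hecke factorisation of `ζ_E`
  obtain ⟨χ₁, 𝔣, χc, pc, Lc, hinj₁, hdata, -, hval₁, h𝔣0, -, hnt₁, -, hdisc, hLc, hζ₁, -⟩ :=
    CyclicExtension.exists_primitive_heckeFactorisation K E
  rw [hdegKE] at hnt₁ hdisc hLc hζ₁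
  have h21 : ¬ (2 ∣ 1) := by norm_num
  obtain ⟨hL₁d, hL₁s⟩ := hLc 1 h21
  obtain ⟨h𝔣1, hχc, hprimc, hpc⟩ := hdata 1
  -- `χ₁ = χ` on values
  have hχ₁χ : ∀ g : E ≃ₐ[K] E, ((χ₁ g : ℂˣ) : ℂ) = ((χ g : ℂˣ) : ℂ) := by
    intro g
    by_cases hg : g = 1
    · subst hg; simp
    · have h1 : ((χ₁ g : ℂˣ) : ℂ) ^ 2 = 1 := by
        rw [← Units.val_pow_eq_pow_val, ← map_pow, hsq1 g, map_one, Units.val_one]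
      rcases sq_eq_one_iff.mp h1 with h | h
      · exfalso; apply hg; apply hinj₁; rw [map_one]; exact Units.ext h
      · rcases hpm g with h' | h'
        · exact absurd (hone g h') hg
        · rw [h, h']
  -- the characters `χc 1 mod 𝔣 1` and `D.χ₀ mod D.𝔣` agree off `𝔪`
  have hagree : ∀ v : HeightOneSpectrum (𝓞 K), ¬ 𝔪 ≤ v.asIdeal → D.χ₀ v = χc 1 v := by
    intro v hv
    rw [D.agree v hv, hval v hv, hval₁ 1 v (hunrE v hv), pow_one, hχ₁χ]
  -- (4) the moduli coincide
  set 𝔫 : Ideal (𝓞 K) := 𝔪 * 𝔣 1 with h𝔫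
  have h𝔫0 : 𝔫 ≠ ⊥ := by
    rw [h𝔫, Ne, Ideal.mul_eq_bot, not_or]; exact ⟨h𝔪, h𝔣1⟩
  have h𝔫𝔣 : 𝔫 ≤ D.𝔣 := le_trans Ideal.mul_le_right D.le
  have h𝔫𝔣' : 𝔫 ≤ 𝔣 1 := Ideal.mul_le_left
  have hagree𝔫 : ∀ v : HeightOneSpectrum (𝓞 K), ¬ 𝔫 ≤ v.asIdeal → D.χ₀ v = χc 1 v :=
    fun v hv ↦ hagree v (fun h ↦ hv (le_trans Ideal.mul_le_right h))
  obtain ⟨h𝔣eq, -⟩ := IsPrimitive.modulus_unique h𝔫0 h𝔫𝔣 h𝔫𝔣' hagree𝔫 D.isRayClassCharacter D.isPrimitive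
    D.isSignType hχc hprimc hpc
  -- (5) the characters agree off the conductor, the `L`-functions coincide
  have hχc' : IsRayClassCharacter D.𝔣 (χc 1) := by rw [h𝔣eq]; exact hχc
  have hagree' : ∀ v : HeightOneSpectrum (𝓞 K), ¬ D.𝔣 ≤ v.asIdeal → D.χ₀ v = χc 1 v :=
    rayChar_congr_of_agree_off D.ne_bot h𝔫0 D.isRayClassCharacter hχc' hagree𝔫
  have hLeq : D.L = Lc 1 := by
    have h := AnalyticOnNhd.eqOn_of_preconnected_of_eventuallyEq (𝕜 := ℂ)
      (D.differentiable.differentiableOn.analyticOnNhd isOpen_univ) (hL₁d.differentiableOn.analyticOnNhd isOpen_univ)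
      isPreconnected_univ (Set.mem_univ (2 : ℂ)) ?_
    · exact funext fun s ↦ h (Set.mem_univ s)
    · refine eventually_of_mem ((continuous_re.isOpen_preimage _ isOpen_Ioi).mem_nhds (by simp : 1 < (2 : ℂ).re))
        fun t (ht : 1 < t.re) ↦ ?_
      rw [D.L_eq t ht, rayClassLSeries_congr D.ne_bot hagree' t, h𝔣eq, hL₁s t ht]
  have hζE : dedekindZeta₁ E β₁ = 0 := by
    rw [hζ₁ (β₁ : ℂ)]
    have : ∏ j ∈ Finset.Ico 1 2, Lc j (β₁ : ℂ) = Lc 1 β₁ := by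
      rw [show Finset.Ico 1 2 = {1} by decide, Finset.prod_singleton]
    rw [this, ← hLeq, h0, mul_zero]
  -- (6) Stark for `ζ_E`
  have hβ1ne : ((β₁ : ℝ) : ℂ) ≠ 1 := by
    intro h; apply hβ1.ne; exact_mod_cast h
  have hLz : classGroupLFunction E 1 β₁ = 0 := by
    have h := classGroupLFunction_eq_zero_of_famF (K := E) 0 (by rw [famF_zero]; exact hζE) hβ1ne
    rwa [toHomUnits_toMulHom_zero] at h
  have hst := hstark E hdegE β₁ hβ1 hLz
  -- (7) `condQn E ≤ Q_𝔪⁴`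
  set R : ℝ := rayCondQ K 𝔪 with hR
  have hR12 : (12 : ℝ) ≤ R := twelve_le_rayCondQ hK h𝔪
  have hR1 : (1 : ℝ) ≤ R := by linarith
  have hdiscE : ((discr E).natAbs : ℝ) = ((discr K).natAbs : ℝ) ^ 2 * (Ideal.absNorm (𝔣 1) : ℕ) := by
    have h := hdisc
    rw [Finset.prod_range_succ, Finset.prod_range_succ, Finset.prod_range_zero, one_mul, h𝔣0,
      Ideal.absNorm_top, mul_one] at h
    have h' : ((discr K).natAbs : ℝ) * (((discr K).natAbs : ℝ) * (Ideal.absNorm (𝔣 1) : ℕ)) =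
        ((discr E).natAbs : ℝ) := by exact_mod_cast h
    rw [← h']; ring
  have hN1 : ((Ideal.absNorm (𝔣 1) : ℕ) : ℝ) ≤ (Ideal.absNorm 𝔪 : ℕ) := by
    rw [← h𝔣eq]; exact D.absNorm_le
  have hd0 : (0 : ℝ) ≤ ((discr K).natAbs : ℝ) := Nat.cast_nonneg _
  have hm1 : (1 : ℝ) ≤ ((Ideal.absNorm 𝔪 : ℕ) : ℝ) := one_le_absNorm_cast h𝔪
  have hn2 : (2 : ℝ) ≤ n := by exact_mod_cast hK
  have hnn : (4 : ℝ) ^ n ≤ ((n : ℝ) ^ n) ^ 2 := by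
    rw [← pow_mul, show n * 2 = 2 * n by ring, pow_mul]
    exact pow_le_pow_left₀ (by norm_num) (by nlinarith) n
  have hcondE : ThornerZaman.condQn E ≤ R ^ (4 : ℕ) := by
    unfold ThornerZaman.condQn
    rw [hdegE, show |(discr E : ℝ)| = ((discr E).natAbs : ℝ) by rw [Nat.cast_natAbs, Int.cast_abs], hdiscE]
    have hR' : R = ((discr K).natAbs : ℝ) * (n : ℝ) ^ n * ((Ideal.absNorm 𝔪 : ℕ) : ℝ) := by
      rw [hR]; unfold rayCondQ ThornerZaman.condQn; rw [Nat.cast_natAbs, Int.cast_abs]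
    have h2n : ((2 * n : ℕ) : ℝ) ^ (2 * n) = (4 : ℝ) ^ n * ((n : ℝ) ^ n) ^ 2 := by
      push_cast
      rw [mul_pow, pow_mul, pow_mul]; norm_num
      ring
    rw [h2n, hR']
    -- `d² N𝔣₁ 4ⁿ n^{2n} ≤ (d nⁿ N𝔪)⁴`
    have hA : ((discr K).natAbs : ℝ) ^ 2 * ((Ideal.absNorm (𝔣 1) : ℕ) : ℝ) ≤
        ((discr K).natAbs : ℝ) ^ 2 * ((Ideal.absNorm 𝔪 : ℕ) : ℝ) := mul_le_mul_of_nonneg_left hN1 (by positivity)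
    have hd1 : (1 : ℝ) ≤ ((discr K).natAbs : ℝ) := by exact_mod_cast Int.natAbs_pos.mpr (discr_ne_zero K)
    have hnn1 : (1 : ℝ) ≤ (n : ℝ) ^ n := one_le_pow₀ (by linarith)
    calc ((discr K).natAbs : ℝ) ^ 2 * ((Ideal.absNorm (𝔣 1) : ℕ) : ℝ) * ((4 : ℝ) ^ n * ((n : ℝ) ^ n) ^ 2)
        ≤ ((discr K).natAbs : ℝ) ^ 2 * ((Ideal.absNorm 𝔪 : ℕ) : ℝ) * (((n : ℝ) ^ n) ^ 2 * ((n : ℝ) ^ n) ^ 2) :=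
          mul_le_mul hA (mul_le_mul_of_nonneg_right hnn (by positivity)) (by positivity) (by positivity)
      _ ≤ (((discr K).natAbs : ℝ) * (n : ℝ) ^ n * ((Ideal.absNorm 𝔪 : ℕ) : ℝ)) ^ (4 : ℕ) := by
          have e : (((discr K).natAbs : ℝ) * (n : ℝ) ^ n * ((Ideal.absNorm 𝔪 : ℕ) : ℝ)) ^ (4 : ℕ) =
              ((discr K).natAbs : ℝ) ^ 2 * ((Ideal.absNorm 𝔪 : ℕ) : ℝ) * (((n : ℝ) ^ n) ^ 2 * ((n : ℝ) ^ n) ^ 2) *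
                (((discr K).natAbs : ℝ) ^ 2 * ((Ideal.absNorm 𝔪 : ℕ) : ℝ) ^ 3) := by ring
          rw [e]
          have h1 : (1 : ℝ) ≤ ((discr K).natAbs : ℝ) ^ 2 * ((Ideal.absNorm 𝔪 : ℕ) : ℝ) ^ 3 :=
            one_le_mul_of_one_le_of_one_le (one_le_pow₀ hd1) (one_le_pow₀ hm1)
          have h0 : 0 ≤ ((discr K).natAbs : ℝ) ^ 2 * ((Ideal.absNorm 𝔪 : ℕ) : ℝ) *
              (((n : ℝ) ^ n) ^ 2 * ((n : ℝ) ^ n) ^ 2) := by positivity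
          nlinarith
  -- (8) conclude
  have hcE0 : 0 < ThornerZaman.condQn E := by
    have := ThornerZaman.twelve_le_condQn (K := E) (by rw [hdegE]; omega); linarith
  have hpow : R ^ (-(8 : ℝ)) ≤ ThornerZaman.condQn E ^ (-(2 : ℝ)) := by
    have h1 : ThornerZaman.condQn E ^ (2 : ℝ) ≤ (R ^ (4 : ℕ)) ^ (2 : ℝ) :=
      Real.rpow_le_rpow hcE0.le hcondE (by norm_num)
    have h2 : (R ^ (4 : ℕ)) ^ (2 : ℝ) = R ^ (8 : ℝ) := by
      rw [← Real.rpow_natCast, ← Real.rpow_mul (by linarith)]; norm_num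
    rw [Real.rpow_neg (by linarith), Real.rpow_neg hcE0.le]
    rw [h2] at h1
    exact inv_anti₀ (Real.rpow_pos_of_pos hcE0 _) h1
  calc c * R ^ (-(8 : ℝ)) ≤ c * ThornerZaman.condQn E ^ (-(2 : ℝ)) := mul_le_mul_of_nonneg_left hpow hc.le
    _ ≤ 1 - β₁ := hst

/-! ### The theorem -/

/-- **Effective repulsion of the exceptional zero of a real Hecke character of a congruence class group from
`s = 1`** (see the module docstring): `∃ c₁ = c₁(n) ∈ (0,1]`, `c₁ Q_𝔪^{−8} ≤ 1 − β₁` for every real zero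
`β₁ < 1` of every real member `F_{ψ₁}` of the family, every `K` of degree `n > 1`, every datum.
[cite: Stark1974, Theorem 3] [cite: ChoLemkeOliverZaman2025, §5 Lemma 12] -/
theorem rayRealZero_repulsion (n : ℕ) (hn : 1 < n) :
    ∃ c₁ : ℝ, 0 < c₁ ∧ c₁ ≤ 1 ∧ ∀ (K : Type) [Field K] [NumberField K], Module.finrank ℚ K = n →
    ∀ (G : Type) [CommGroup G] [Finite G] (𝔪 : Ideal (𝓞 K)) (f : HeightOneSpectrum (𝓞 K) → G)
      (h𝔪 : 𝔪 ≠ ⊥) (hray : ArtinKillsRay 𝔪 f)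
      (hsep : ∀ χ : AddChar (Additive G) ℂ, χ ≠ 0 →
        ∃ v : HeightOneSpectrum (𝓞 K), ¬ 𝔪 ≤ v.asIdeal ∧ χ (Additive.ofMul (f v)) ≠ 1)
      (ψ₁ : AddChar (Additive G) ℂ), ψ₁ + ψ₁ = 0 → ∀ β₁ : ℝ, β₁ < 1 →
        rayFamF h𝔪 hray hsep ψ₁ β₁ = 0 → c₁ * rayCondQ K 𝔪 ^ (-(8 : ℝ)) ≤ 1 - β₁ := by
  obtain ⟨c₁, hc₁, hc₁1, hS₁⟩ := Residue.one_sub_realZero_ge_condQn_rpow n hn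
  obtain ⟨c₂, hc₂, hc₂1, hS₂⟩ := Residue.one_sub_realZero_ge_condQn_rpow (2 * n) (by omega)
  refine ⟨min c₁ c₂, lt_min hc₁ hc₂, (min_le_left _ _).trans hc₁1,
    fun K _ _ hKn G _ _ 𝔪 f h𝔪 hray hsep ψ₁ hreal β₁ hβ1 h0 ↦ ?_⟩
  have hK : 1 < Module.finrank ℚ K := by rw [hKn]; exact hn
  set R : ℝ := rayCondQ K 𝔪 with hR
  have hR12 : (12 : ℝ) ≤ R := twelve_le_rayCondQ hK h𝔪
  have hR1 : (1 : ℝ) ≤ R := by linarith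
  have hRm8 : R ^ (-(8 : ℝ)) ≤ 1 := Real.rpow_le_one_of_one_le_of_nonpos hR1 (by norm_num)
  have hRm8' : 0 < R ^ (-(8 : ℝ)) := Real.rpow_pos_of_pos (by linarith) _
  have hmin1 : min c₁ c₂ ≤ 1 := (min_le_left _ _).trans hc₁1
  -- `β₁ ≤ 0` is trivial
  rcases le_or_gt β₁ 0 with hβ0 | hβ0
  · have : min c₁ c₂ * R ^ (-(8 : ℝ)) ≤ 1 := (mul_le_mul hmin1 hRm8 hRm8'.le zero_le_one).trans (by norm_num)
    linarith
  have hβ1ne : ((β₁ : ℝ) : ℂ) ≠ 1 := by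
    intro h; apply hβ1.ne; exact_mod_cast h
  -- `condQn K ≤ R ≤ R⁴`, so `R^{-8} ≤ condQn K ^ {-2}`
  have hQK : ThornerZaman.condQn K ≤ R := condQn_le_rayCondQ h𝔪
  have hQK0 : 0 < ThornerZaman.condQn K := by
    have := ThornerZaman.twelve_le_condQn (K := K) hK; linarith
  have hpowK : R ^ (-(8 : ℝ)) ≤ ThornerZaman.condQn K ^ (-(2 : ℝ)) := by
    have h1 : ThornerZaman.condQn K ^ (2 : ℝ) ≤ R ^ (8 : ℝ) := by
      calc ThornerZaman.condQn K ^ (2 : ℝ) ≤ R ^ (2 : ℝ) := Real.rpow_le_rpow hQK0.le hQK (by norm_num)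
        _ ≤ R ^ (8 : ℝ) := Real.rpow_le_rpow_of_exponent_le hR1 (by norm_num)
    rw [Real.rpow_neg (by linarith), Real.rpow_neg hQK0.le]
    exact inv_anti₀ (Real.rpow_pos_of_pos hQK0 _) h1
  by_cases hψ : ψ₁ = 0
  · -- `F_0 = ζ₁_K`: Stark for `ζ_K`
    subst hψ
    rw [rayFamF_zero] at h0
    have hLz : classGroupLFunction K 1 β₁ = 0 := by
      have h := classGroupLFunction_eq_zero_of_famF (K := K) 0 (by rw [famF_zero]; exact h0) hβ1ne
      rwa [toHomUnits_toMulHom_zero] at h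
    have hst := hS₁ K hKn 1 (by ext; simp) β₁ hβ1 hLz
    calc min c₁ c₂ * R ^ (-(8 : ℝ)) ≤ c₁ * ThornerZaman.condQn K ^ (-(2 : ℝ)) :=
          mul_le_mul (min_le_left _ _) hpowK hRm8'.le hc₁.le
      _ ≤ 1 - β₁ := hst
  · -- `F_{ψ₁} = L_{ψ₁}`: the descent
    rw [rayFamF_of_ne h𝔪 hray hsep hψ] at h0
    have hstark : ∀ (E : Type) [Field E] [NumberField E], Module.finrank ℚ E = 2 * Module.finrank ℚ K →
        ∀ β : ℝ, β < 1 → classGroupLFunction E 1 β = 0 → c₂ * ThornerZaman.condQn E ^ (-(2 : ℝ)) ≤ 1 - β :=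
      fun E _ _ hE β hβ hz ↦ hS₂ E (by rw [hE, hKn]) 1 (by ext; simp) β hβ hz
    have h := one_sub_realZero_ge_of_descent h𝔪 hray hsep hK hψ hreal hβ1 h0 hc₂ hstark
    calc min c₁ c₂ * R ^ (-(8 : ℝ)) ≤ c₂ * R ^ (-(8 : ℝ)) :=
          mul_le_mul_of_nonneg_right (min_le_right _ _) hRm8'.le
      _ ≤ 1 - β₁ := h

end Summit.QuantumAdvantage.QuantumAdvantage.Theorems.DegreeOnePrimesEscape

end
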